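import Literature.AlgebraicGeometry.HodgeTheory.GoursatKolchinRibetLieAlgebra
import Literature.Algebra.Lie.RibetLemmaSimpleQuotient
import Literature.Algebra.Lie.SpecialLinearAutomorphisms
import HarnessLib

/-!
# Goursat–Kolchin–Ribet, the Goursat core in matrix form: a block kernel of `(Δ^Zar)°` contains a
# transvection, or two factors are twist-isomorphic (Katz 1990, proof of Prop. 1.8.2: Lie theory, Ribet's
# lemma, Goursat's lemma, `Aut 𝔰𝔩ₙ`)

Layer `Literature/AlgebraicGeometry/HodgeTheory` (companion of `GoursatKolchinRibetCriterion` /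
`GoursatKolchinRibetKernels` / `GoursatKolchinRibetLieAlgebra`). ONE theorem, matrix side over an
algebraically closed field `k` of characteristic `0` (types in `Type`, so that the cited fact
`Jacobson1962_sl_automorphisms.{0,0}` applies): let `Δ ≤ GL(⊕ᵢ k^{mᵢ})` (`|mᵢ| ≥ 2`) consist of
block-diagonal matrices, `L = (Δ^Zar)° = identityComponent (zariskiClosure Δ)`, and suppose (hypothesis
(1) of Katz's proposition in lift form) every `u ∈ SL(mᵢ)` is the `i`-th block of an element of `L`, for
every `i`. Then for each `i₀`, EITHER

* (kernel) `L` contains the block-diagonal transvection `1 + (0, …, E_{ab}, …, 0)` (block `i₀`, `a ≠ b`)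
  — a non-scalar element of Katz's kernel `K_{i₀}`, OR
* (twist) there are `j ≠ i₀`, a bijection `e : m_j ≃ m_{i₀}`, an invertible `A` and scalars `c(δ)` with
  `A·δ_j^e = c(δ)·δ_{i₀}·A` for all `δ ∈ Δ` (a twist `ρ_j ≅ χ ⊗ ρ_{i₀}`), or with
  `A·(δ_j^e)^{−t} = c(δ)·δ_{i₀}·A` for all `δ ∈ Δ` (a twist `ρ_j^∨ ≅ χ ⊗ ρ_{i₀}`); here `δ_j^e` is the `j`-th
  block re-indexed along `e`.

Proof (Katz p. 31–32, with the Lie-algebra library of `Literature/NumberTheory/Automorphic`):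
`𝔥 = {X ∈ Lie(L) : every block traceless}` is a Lie subalgebra of `𝔤𝔩` whose block projections
`pⱼ : 𝔥 → 𝔰𝔩(mⱼ)` are Lie homomorphisms, SURJECTIVE by
`GoursatKolchinRibetLieAlgebra.exists_mem_lieAlgebraGL_traceless_blockDiag_eq`; Ribet's lemma
(`RibetLemma.forall_exists_lift_or_exists_bijective_comp_eq`, the `𝔰𝔩(mⱼ)` being simple) gives either
`𝔰𝔩(m_{i₀}) ⊕ 0 ⊆ Lie(L)` — then `exp` of `E_{ab} ⊕ 0` is the transvection
(`exists_mem_coe_eq_one_add_blockDiagonal_single`) — or a Lie isomorphism `ψ : 𝔰𝔩(m_j) ≅ 𝔰𝔩(m_{i₀})` with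
`ψ ∘ p_j = p_{i₀}`; then `|m_j| = |m_{i₀}|` (`dim 𝔰𝔩ₙ = n² − 1`), `ψ` re-indexed is an automorphism of
`𝔰𝔩(m_{i₀})`, hence `±Ad(A⁻¹)(ᵀ)` by the cited `Jacobson1962_sl_automorphisms` (Jacobson IX.5 Thm 5); `ψ` is
`Ad(Δ)`-equivariant because `Lie(L)` is `Ad(Δ)`-stable, and Schur's lemma
(`exists_smul_of_conj_eq`, `exists_smul_of_conj_transpose_eq`) yields the twist.

The Hodge-vocabulary consequence — the Goursat core `hcore` of
`GoursatKolchinRibetKernels.Katz1990_goursatKolchinRibet_specialLinear'_of_kernels`, hence the named fact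
`Katz1990_goursatKolchinRibet_specialLinear'` modulo `Jacobson1962_sl_automorphisms` — is drawn in
`GoursatKolchinRibetHolds`. Crux K1 of `Summits/HodgeConjecture/HodgeConjecture/Theses/CyclicUnitaryPowers.lean`
(cell `hodge-nonav`); written by the prover seat `hodge-nonav-prover-Ax`.

## References
* [Katz1990ESDE] N. M. Katz, *Exponential Sums and Differential Equations* (1990), §1.8, Prop. 1.8.2 and proof.
* [Ribet1976RealMultiplications] K. A. Ribet, Amer. J. Math. 98 (1976), pp. 790–791.
* [Jacobson1962LieAlgebras] N. Jacobson, *Lie Algebras* (1962), Ch. IX §5 Theorem 5.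
-/

noncomputable section

open scoped MatrixGroups

namespace Literature.AlgebraicGeometry.HodgeTheory

open Matrix Module Literature.NumberTheory.Automorphic LieAlgebra LieAlgebra.SpecialLinear

variable {k : Type} [Field k] [IsAlgClosed k] [CharZero k] {ι : Type} [Fintype ι] [DecidableEq ι]
  {m : ι → Type} [∀ i, Fintype (m i)] [∀ i, DecidableEq (m i)]

/-- **The Goursat core of the Goursat–Kolchin–Ribet criterion, matrix form** (Katz 1990, proof of
Prop. 1.8.2, from "By Lie theory, it suffices to prove that `Lie(G) = Π Lie(Gᵢ)`" to the end), modulo the cited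
classification of `Aut 𝔰𝔩ₙ` (`Jacobson1962_sl_automorphisms`).  For `Δ ≤ GL(⊕ᵢ k^{mᵢ})` block diagonal
(`k` algebraically closed of characteristic `0`, `|mᵢ| ≥ 2`), `L = identityComponent (zariskiClosure Δ)`, and
every `SL(mᵢ)` consisting of `i`-th blocks of elements of `L`: for each `i₀`, either `L` contains a transvection
`1 + (0,…,E_{ab},…,0)` supported in block `i₀` (`a ≠ b`), or some other factor `j ≠ i₀` is twist-isomorphic to
the factor `i₀` on `Δ` — `A δ_j^e = c_δ δ_{i₀} A` for all `δ ∈ Δ`, or `A (δ_j^e)^{−t} = c_δ δ_{i₀} A` for all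
`δ ∈ Δ` — for a bijection `e : m_j ≃ m_{i₀}` (`δ_j^e = (δ_j).submatrix e⁻¹ e⁻¹`) and an invertible `A`. See the
module docstring for the proof. [cite: Katz1990ESDE, §1.8 Prop. 1.8.2 (proof)]
[cite: Ribet1976RealMultiplications, pp. 790–791] [cite: Jacobson1962LieAlgebras, Ch. IX §5 Theorem 5 (p. 283)] -/
theorem goursatCore_blockDiagonal
    (hJ : Literature.Algebra.Lie.SpecialLinearAutomorphisms.Jacobson1962_sl_automorphisms.{0, 0})
    (hm : ∀ i, 2 ≤ Fintype.card (m i)) (Δ : Subgroup (GL (Σ i, m i) k))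
    (hΔ : ∀ δ ∈ Δ, ∀ a b : Σ i, m i, a.1 ≠ b.1 → (δ : Matrix (Σ i, m i) (Σ i, m i) k) a b = 0)
    (h1 : ∀ i, ∀ u : Matrix (m i) (m i) k, u.det = 1 →
      ∃ g ∈ identityComponent (zariskiClosure Δ), blockDiag' (g : Matrix (Σ i, m i) (Σ i, m i) k) i = u)
    (i₀ : ι) :
    (∃ g ∈ identityComponent (zariskiClosure Δ), ∃ a b : m i₀, a ≠ b ∧
        (g : Matrix (Σ i, m i) (Σ i, m i) k) =
          1 + blockDiagonal' (Pi.single (M := fun j => Matrix (m j) (m j) k) i₀ (single a b (1 : k)))) ∨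
      ∃ j, j ≠ i₀ ∧ ∃ e : m j ≃ m i₀, ∃ A : Matrix (m i₀) (m i₀) k, IsUnit A.det ∧
        ((∀ δ ∈ Δ, ∃ c : k,
            A * (blockDiag' (δ : Matrix (Σ i, m i) (Σ i, m i) k) j).submatrix e.symm e.symm =
              c • (blockDiag' (δ : Matrix (Σ i, m i) (Σ i, m i) k) i₀ * A)) ∨
          (∀ δ ∈ Δ, ∃ c : k,
            A * (((blockDiag' (δ : Matrix (Σ i, m i) (Σ i, m i) k) j).submatrix e.symm e.symm)ᵀ)⁻¹ =
              c • (blockDiag' (δ : Matrix (Σ i, m i) (Σ i, m i) k) i₀ * A))) := by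
  classical
  -- the commutator Lie algebra structure on matrices (Mathlib's non-instance `LieRing.ofAssociativeRing`, the one
  -- carried by `sl`), for this proof
  letI : LieRing (Matrix (Σ i, m i) (Σ i, m i) k) := LieRing.ofAssociativeRing
  letI : LieAlgebra k (Matrix (Σ i, m i) (Σ i, m i) k) := LieAlgebra.ofAssociativeAlgebra
  letI : ∀ j, LieRing (Matrix (m j) (m j) k) := fun j => LieRing.ofAssociativeRing
  set L := identityComponent (zariskiClosure Δ) with hLdef
  have hLalg : IsAlgebraicSubgroup L := isAlgebraicSubgroup_identityComponent (isAlgebraicSubgroup_zariskiClosure Δ)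
  have hL : ∀ g ∈ L, ∀ a b : Σ i, m i, a.1 ≠ b.1 → (g : Matrix (Σ i, m i) (Σ i, m i) k) a b = 0 :=
    fun g hg => offDiag_eq_zero_of_mem_zariskiClosure hΔ (identityComponent_le _ hg)
  have hbd : ∀ {X : Matrix (Σ i, m i) (Σ i, m i) k}, X ∈ lieAlgebraGL L →
      ∀ a b : Σ i, m i, a.1 ≠ b.1 → X a b = 0 := fun hX => offDiag_eq_zero_of_mem_lieAlgebraGL hL hX
  -- the block-traceless part `𝔥` of `Lie(L)`, a Lie subalgebra of `𝔤𝔩`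
  let 𝔥 : LieSubalgebra k (Matrix (Σ i, m i) (Σ i, m i) k) :=
    { carrier := {X | X ∈ lieAlgebraGL L ∧ ∀ j, (blockDiag' X j).trace = 0}
      zero_mem' := ⟨Submodule.zero_mem _, fun j => by rw [blockDiag'_zero, Pi.zero_apply, trace_zero]⟩
      add_mem' := fun {X Y} hX hY => ⟨Submodule.add_mem _ hX.1 hY.1, fun j => by
        rw [blockDiag'_add, Pi.add_apply, trace_add, hX.2, hY.2, add_zero]⟩
      smul_mem' := fun c {X} hX => ⟨Submodule.smul_mem _ c hX.1, fun j => by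
        rw [blockDiag'_smul, Pi.smul_apply, trace_smul, hX.2, smul_zero]⟩
      lie_mem' := fun {X Y} hX hY => ⟨by rw [Ring.lie_def]; exact lie_mem_lieAlgebraGL hX.1 hY.1, fun j => by
        rw [Ring.lie_def]; exact trace_blockDiag'_commutator (hbd hX.1) (hbd hY.1) j⟩ }
  -- the block projections `p j : 𝔥 → 𝔰𝔩(m j)`, Lie homomorphisms
  let p : ∀ j, 𝔥 →ₗ⁅k⁆ sl (m j) k := fun j =>
    { toFun := fun X => ⟨blockDiag' (X : Matrix (Σ i, m i) (Σ i, m i) k) j, X.2.2 j⟩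
      map_add' := fun X Y => Subtype.ext (by
        change blockDiag' ((X : Matrix (Σ i, m i) (Σ i, m i) k) + (Y : Matrix (Σ i, m i) (Σ i, m i) k)) j =
          blockDiag' (X : Matrix _ _ k) j + blockDiag' (Y : Matrix _ _ k) j
        rw [blockDiag'_add, Pi.add_apply])
      map_smul' := fun c X => Subtype.ext (by
        change blockDiag' (c • (X : Matrix (Σ i, m i) (Σ i, m i) k)) j = c • blockDiag' (X : Matrix _ _ k) j
        rw [blockDiag'_smul, Pi.smul_apply])
      map_lie' := fun {X Y} => Subtype.ext (by
        change blockDiag' (((⁅X, Y⁆ : 𝔥) : Matrix (Σ i, m i) (Σ i, m i) k)) j =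
          (((⁅(⟨blockDiag' (X : Matrix (Σ i, m i) (Σ i, m i) k) j, X.2.2 j⟩ : sl (m j) k),
              (⟨blockDiag' (Y : Matrix (Σ i, m i) (Σ i, m i) k) j, Y.2.2 j⟩ : sl (m j) k)⁆ : sl (m j) k)) :
            Matrix (m j) (m j) k)
        rw [LieSubalgebra.coe_bracket, LieSubalgebra.coe_bracket, Ring.lie_def, Ring.lie_def]
        exact blockDiag'_commutator (hbd X.2.1) (hbd Y.2.1) j) }
  have hp : ∀ j (X : 𝔥), ((p j X : sl (m j) k) : Matrix (m j) (m j) k) = blockDiag' (X : Matrix _ _ k) j :=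
    fun _ _ => rfl
  -- surjectivity of the projections (hypothesis (1) in lift form, logarithms, brackets)
  have hsurj : ∀ j, Function.Surjective (p j) := by
    intro j Y
    obtain ⟨X, hX, hXt, hXj⟩ := exists_mem_lieAlgebraGL_traceless_blockDiag_eq hLalg hL j (hm j) (h1 j) Y.2
    exact ⟨⟨X, hX, hXt⟩, Subtype.ext hXj⟩
  haveI : ∀ j, LieAlgebra.IsSimple k (sl (m j) k) := fun j =>
    Literature.Algebra.Lie.SpecialLinearSimple.isSimple_sl_of_charZero (m j) k (hm j)
  -- Ribet's dichotomy at `i₀`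
  rcases Literature.Algebra.Lie.RibetLemma.forall_exists_lift_or_exists_bijective_comp_eq p Finset.univ
      (fun j _ => hsurj j) (Finset.mem_univ i₀) with hlift | ⟨j, -, hji, ψ, hψ, hcomp⟩
  · -- Case A: `𝔰𝔩(m i₀) ⊕ 0 ⊆ Lie(L)`; exponentiate a transvection
    left
    obtain ⟨a, b, hab⟩ := Fintype.exists_pair_of_one_lt_card (hm i₀)
    have hEsl : single a b (1 : k) ∈ sl (m i₀) k := trace_single_eq_of_ne a b (1 : k) hab
    obtain ⟨x, hxa, hx0⟩ := hlift ⟨single a b 1, hEsl⟩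
    have hxE : (x : Matrix (Σ i, m i) (Σ i, m i) k) =
        blockDiagonal' (Pi.single (M := fun j => Matrix (m j) (m j) k) i₀ (single a b (1 : k))) := by
      rw [← blockDiagonal'_blockDiag'_of_offDiag (hbd x.2.1)]
      congr 1
      funext j
      by_cases hj : j = i₀
      · subst hj
        rw [Pi.single_eq_same]
        exact congrArg Subtype.val hxa
      · rw [Pi.single_eq_of_ne hj]
        exact congrArg Subtype.val (hx0 j (Finset.mem_univ j) hj)
    have hmem : blockDiagonal' (Pi.single (M := fun j => Matrix (m j) (m j) k) i₀ (single a b (1 : k))) ∈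
        lieAlgebraGL L := hxE ▸ x.2.1
    obtain ⟨g, hg, hgE⟩ := exists_mem_coe_eq_one_add_blockDiagonal_single hLalg i₀
      (single_mul_single_of_ne (1 : k) a b a hab.symm 1) hmem
    exact ⟨g, hg, a, b, hab, hgE⟩
  · -- Case B: a Lie isomorphism `ψ : 𝔰𝔩(m j) ≅ 𝔰𝔩(m i₀)` with `ψ ∘ p j = p i₀`
    right
    haveI : Nonempty (m j) := Fintype.card_pos_iff.1 (by linarith [hm j])
    haveI : Nonempty (m i₀) := Fintype.card_pos_iff.1 (by linarith [hm i₀])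
    -- `|m j| = |m i₀|`
    have hcard : Fintype.card (m j) = Fintype.card (m i₀) := by
      have h := LinearEquiv.finrank_eq (LinearEquiv.ofBijective (ψ : sl (m j) k →ₗ[k] sl (m i₀) k) hψ)
      rw [finrank_sl, finrank_sl] at h
      have ha : 1 ≤ Fintype.card (m j) ^ 2 := Nat.one_le_pow _ _ (by linarith [hm j])
      have hb : 1 ≤ Fintype.card (m i₀) ^ 2 := Nat.one_le_pow _ _ (by linarith [hm i₀])
      exact Nat.pow_left_injective two_ne_zero (by simpa using (show Fintype.card (m j) ^ 2 = Fintype.card (m i₀) ^ 2 by omega))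
    obtain ⟨e⟩ : Nonempty (m j ≃ m i₀) := ⟨Fintype.equivOfCardEq hcard⟩
    -- re-index: `ρ : 𝔰𝔩(m i₀) → 𝔰𝔩(m j)`, `ρ X = X.submatrix e e`, and the automorphism `φ = ψ ∘ ρ`
    obtain ⟨ρ, hρbij, hρ⟩ := exists_lieHom_sl_reindex (k := k) e
    let φ : sl (m i₀) k ≃ₗ⁅k⁆ sl (m i₀) k := LieEquiv.ofBijective (ψ.comp ρ) (hψ.comp hρbij)
    have hφ : ∀ X, φ X = ψ (ρ X) := fun X => rfl
    have hψp : ∀ x : 𝔥, ψ (p j x) = p i₀ x := fun x => LieHom.congr_fun hcomp x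
    -- equivariance: `φ (S' Z S'⁻¹) = S φ(Z) S⁻¹` with `S = δ_{i₀}`, `S' = δ_j^e`
    have hequiv : ∀ δ ∈ Δ, ∀ Z : sl (m i₀) k,
        ∃ hZ : (blockDiag' (δ : Matrix (Σ i, m i) (Σ i, m i) k) j).submatrix e.symm e.symm * (Z : Matrix (m i₀) (m i₀) k) *
            ((blockDiag' (δ : Matrix (Σ i, m i) (Σ i, m i) k) j).submatrix e.symm e.symm)⁻¹ ∈ sl (m i₀) k,
          ((φ ⟨_, hZ⟩ : sl (m i₀) k) : Matrix (m i₀) (m i₀) k) =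
            blockDiag' (δ : Matrix (Σ i, m i) (Σ i, m i) k) i₀ * (φ Z : Matrix (m i₀) (m i₀) k) *
              (blockDiag' (δ : Matrix (Σ i, m i) (Σ i, m i) k) i₀)⁻¹ := by
      intro δ hδ Z
      have hδbd := hΔ δ hδ
      set S := blockDiag' (δ : Matrix (Σ i, m i) (Σ i, m i) k) i₀ with hS
      set Sj := blockDiag' (δ : Matrix (Σ i, m i) (Σ i, m i) k) j with hSj
      -- lift `ρ Z` to `x ∈ 𝔥` and conjugate by `δ`
      obtain ⟨x, hx⟩ := hsurj j (ρ Z)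
      have hx' : (δ : Matrix (Σ i, m i) (Σ i, m i) k) * (x : Matrix _ _ k) * ((δ⁻¹ : GL (Σ i, m i) k) : Matrix _ _ k) ∈ 𝔥 :=
        ⟨conj_mem_lieAlgebraGL_identityComponent_zariskiClosure hδ x.2.1, fun l => by
          rw [trace_blockDiag'_conj hδbd (hbd x.2.1)]; exact x.2.2 l⟩
      set x' : 𝔥 := ⟨_, hx'⟩ with hx'def
      have hpx' : ∀ l, ((p l x' : sl (m l) k) : Matrix (m l) (m l) k) =
          blockDiag' (δ : Matrix (Σ i, m i) (Σ i, m i) k) l * blockDiag' (x : Matrix _ _ k) l *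
            (blockDiag' (δ : Matrix (Σ i, m i) (Σ i, m i) k) l)⁻¹ := fun l => blockDiag'_conj hδbd (hbd x.2.1) l
      -- the traceless matrix `S' Z S'⁻¹` is `(p j x').submatrix e⁻¹ e⁻¹`
      have hxj : blockDiag' (x : Matrix _ _ k) j = (Z : Matrix (m i₀) (m i₀) k).submatrix e e := by
        rw [← hp, hx, hρ]
      have hZ' : Sj.submatrix e.symm e.symm * (Z : Matrix (m i₀) (m i₀) k) * (Sj.submatrix e.symm e.symm)⁻¹ =
          ((p j x' : sl (m j) k) : Matrix (m j) (m j) k).submatrix e.symm e.symm := by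
        rw [hpx' j, hxj, inv_submatrix_equiv, ← hSj]
        conv_lhs => rw [show (Z : Matrix (m i₀) (m i₀) k) = ((Z : Matrix (m i₀) (m i₀) k).submatrix e e).submatrix e.symm e.symm by
          rw [submatrix_submatrix, Equiv.self_comp_symm, submatrix_id_id]]
        rw [submatrix_mul_equiv, submatrix_mul_equiv]
      have hZmem : Sj.submatrix e.symm e.symm * (Z : Matrix (m i₀) (m i₀) k) * (Sj.submatrix e.symm e.symm)⁻¹ ∈ sl (m i₀) k := by
        rw [hZ']
        change Matrix.trace _ = 0
        rw [trace_submatrix_equiv]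
        exact (p j x').2
      refine ⟨hZmem, ?_⟩
      -- `ρ ⟨S' Z S'⁻¹⟩ = p j x'`, so `φ ⟨S' Z S'⁻¹⟩ = ψ (p j x') = p i₀ x'`
      have hρZ' : ρ ⟨_, hZmem⟩ = p j x' := by
        apply Subtype.ext
        rw [hρ]
        change (Sj.submatrix e.symm e.symm * (Z : Matrix (m i₀) (m i₀) k) * (Sj.submatrix e.symm e.symm)⁻¹).submatrix e e = _
        rw [hZ', submatrix_submatrix, Equiv.symm_comp_self, submatrix_id_id]
      have hρZ : ρ Z = p j x := hx.symm
      rw [hφ, hφ, hρZ', hρZ, hψp, hψp, hp, hp]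
      exact hpx' i₀
    -- invertibility of the blocks
    have hdetS : ∀ δ ∈ Δ, IsUnit (blockDiag' (δ : Matrix (Σ i, m i) (Σ i, m i) k) i₀).det := fun δ hδ =>
      isUnit_iff_ne_zero.2 (det_blockDiag'_ne_zero (hΔ δ hδ) i₀)
    have hdetS' : ∀ δ ∈ Δ, IsUnit ((blockDiag' (δ : Matrix (Σ i, m i) (Σ i, m i) k) j).submatrix e.symm e.symm).det :=
      fun δ hδ => by
        rw [det_submatrix_equiv_self]
        exact isUnit_iff_ne_zero.2 (det_blockDiag'_ne_zero (hΔ δ hδ) j)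
    -- Jacobson: `φ = Ad(A⁻¹)` or `−Ad(A⁻¹) ∘ ᵀ`
    obtain ⟨A, hA, hform⟩ := hJ k (m i₀) (hm i₀) φ
    have hAdet : IsUnit A.det := (isUnit_iff_isUnit_det A).1 hA
    have hAinv : IsUnit A⁻¹.det := by
      rw [det_nonsing_inv, isUnit_ringInverse]
      exact hAdet
    refine ⟨j, hji, e, A⁻¹, hAinv, ?_⟩
    rcases hform with hplus | ⟨-, hminus⟩
    · -- `φ X = A⁻¹ X A`: twist `ρ_j ≅ χ ⊗ ρ_{i₀}`
      left
      intro δ hδ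
      refine exists_smul_of_conj_eq hAdet (hdetS δ hδ) (hdetS' δ hδ) fun Z hZ => ?_
      obtain ⟨hZ', hφZ'⟩ := hequiv δ hδ ⟨Z, hZ⟩
      rw [hplus, hplus] at hφZ'
      exact hφZ'
    · -- `φ X = −A⁻¹ Xᵀ A`: twist `ρ_j^∨ ≅ χ ⊗ ρ_{i₀}`
      right
      intro δ hδ
      refine exists_smul_of_conj_transpose_eq hAdet (hdetS δ hδ) (hdetS' δ hδ) fun Z hZ => ?_
      obtain ⟨hZ', hφZ'⟩ := hequiv δ hδ ⟨Z, hZ⟩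
      rw [hminus, hminus] at hφZ'
      exact hφZ'

end Literature.AlgebraicGeometry.HodgeTheory

end
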